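import Summits.AtomisticToContinuum.Crystallization.Theorems.FluxTubeKeplerFloorGivesLayered
import Summits.AtomisticToContinuum.Crystallization.Theorems.FluxTubeKeplerFluxCellKeplerSingleScale
import Summits.AtomisticToContinuum.Crystallization.Theorems.ChessboardParticlePlanesPeriodicWindowsIffCrystallization
import Summits.AtomisticToContinuum.Crystallization.Theorems.FluxTubeKeplerKeplerEnergyFloor

/-!
# `InterlayerBlindRung` — forward rung over `FluxTubeKepler.FloorGivesLayered` (skeleton line; fwd-rung G1, gen 13)

Crux dir `FluxCellKepler` (stmt-AtomisticToContinuum-15221, the only open crux of route `FluxTubeKepler`).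
rung_decl = `Summit.AtomisticToContinuum.Crystallization.Cruxes.FluxCellKepler.SlabLadder.InterlayerBlindRung`;
witness (F3) = `Lines/InterlayerBlindRung_special.lean` (`…SlabLadder.Special.slabRung_univ`); on-path (F4) =
`Lines/InterlayerBlindRung_onpath.lean` (`…SlabLadder.OnPath.InterlayerBlindRung_of_Crystallization`).

FLOOR (seed, proved): `Theorems.FluxTubeKeplerFloorGivesLayered.FloorGivesLayered_proof : FloorGivesLayered` —
FLOOR(P₀) + a budget pricing, at every scale `(R, η)`, the sites whose `R`-BALL is not two-way `η`-matched to an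
admissible layered (Barlow) template ⇒ layered windows ⇒ (proved `PeriodicGivenLayered`) periodic windows.

THE ONE MOVE (hypothesis generalised — the certificate's WINDOW): the floor inspects the whole ball `‖v‖ ≤ R`
around a site; the family `SlabRung W` (`W : Set ℝ` a height window) inspects only the SLAB-BALL
`‖v‖ ≤ R ∧ ⟪v, A ν⟫ ∈ W`, `ν = layerNormal 1` the template's own stacking normal, in BOTH matching clauses.
`W = univ` is the floor (`slabGood_univ_iff`, `slabRung_univ`, F3); the dial is monotone (`slabRung_mono`: a smaller
height window is a weaker budget, hence a STRONGER rung); `S ⇒` every member (`slabRung_of_crystallization`, F4).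
The deciding rung is the THIN slab `W = [-1/2, 1/2]` (half-height below the least admissible gap
`39/50 · 47/50 ≈ 0.733`): `InterlayerBlindRung`.  Its budget prices only the sites whose OWN LAYER is not, within
radius `R`, a perfect triangular patch isolated by empty half-slabs; every INTER-layer datum of the material —
relative rotation (twist) of adjacent layers, lateral registry, interlayer gap, layer-to-layer spacing mismatch —
is never charged and has to be SELECTED BY THE ENERGY inside the proof.  (The thick slabs `W ⊇ [-2, 2]` are flat:
for `R ≥ 2` the slab-ball contains the radius-`2` ball, so the landed chart gluing `FluxCellKeplerSingleScale.card_bad_le`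
already reduces them to the floor; the thin slab contains no ball of radius `> 1/2`, on which every separated site
is trivially good, so no potential-free gluing applies.)

WHY THE FLOOR'S PROOF STOPS: Step 1 of the seed (`eventually_exists_not_bad`) now yields sites that are good only
in the thin slab — each certifies ONE layer; Steps 2–3 (`spacing_selection`, `match_dilate`) need a site whose whole
`R`-ball is layered-good, and no potential-free argument makes one: the stack of perfect triangular layers in which
every other layer is rotated by `30°` (or every layer carries its own spacing `a_m ∈ [47/50, 1]`, or the gaps are
`2`) is thin-slab-good at EVERY site and layered-good at NO site once `R ≫ η`.  What excludes such stacks along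
Lennard-Jones ground states is ENERGY: a twisted or mismatched adjacent pair of rigid triangular layers sees, by
equidistribution of the local disregistry (the Birkhoff property of incommensurate lattice pairs, Cazeaux–Luskin–
Massatt 2020 Prop. 1.2 / 2.2; coset averages for coincidence twists), the AVERAGE of the registry landscape instead
of its hollow-site minimum; a misregistered aligned pair sits off the minimum; an out-of-box gap is off the
interlayer equation of state (exfoliation for large gaps).  None of this is in the floor's potential-blind proof.

THE LINE (three stubs, the only `sorry`s; the matching lemma `nearGood` and the composition `InterlayerBlindRung_of`
are sorry-free):
* `stub_stackOfSlabGood` (potential-free geometry, new): if every site within `R'` of `x i` is thin-slab-good at a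
  scale `(R, η)` with `R ≫ R'`, `η` small, then the `ρ`-ball around `x i` is two-way `ζ`-matched to a LAMINAR
  TRIANGULAR STACK (`stackSet`: parallel planes with gaps `≥ 2/5`, each carrying a perfect triangular lattice with its
  own spacing in the box, its own in-plane rotation and offset) — adjacent certified layers cannot tilt against each
  other without putting a particle into a forbidden half-slab.
* `stub_stackingGap` (THE NEW INPUT, configuration-free: certified lattice-sum numerics + the disregistry average):
  for every locality `(ζ, ρ)` there are `g > 0`, `C` with
  `Σ_{p∈W} e_p(T) ≥ 2e*·#W + 2g·#{p ∈ W : ¬Near ζ ρ T p} − C·∂W` for every finite window `W` of every laminar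
  triangular stack `T` — each site whose `ρ`-environment in `T` is NOT `ζ`-close to an admissible Barlow template
  pays `g` (window-bound currency of the landed `LayeredHull.stub_windowBounds` and of `Lines/AffineBlindRung.lean`).
* `nearGood` (potential-free matching composition; PROVED here, no `sorry` — it is the sibling line's registered
  stub `AffineLadder.stub_nearGood` with the strained template generalised to an arbitrary set `S`): a particle
  matched to a point `q` of a set `S` that two-way matches a big ball, with `S` `Near ζ ρ` an admissible template at
  `q`, is floor-good at scale `(2, η)`.
* `stub_stackingSelection` (Lennard-Jones block accounting along ground states): given the two statements above,
  sparse thin-slab defects at every scale (`FewSlabBad`, what FLOOR + the thin-slab budget give, `fewSlabBad_of_budget`)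
  force sparse radius-`2` floor defects: `∀ η θ > 0`, eventually `#{i : ¬LayeredGood 2 η} ≤ θN`.
Then the landed single-scale chart gluing (`good_of_sparse`), the seed's Steps 2–3 (`hasLayeredWindows_of_good`)
and the proved `PeriodicGivenLayered` give periodic windows: `InterlayerBlindRung_of`.
-/

noncomputable section

namespace Summit.AtomisticToContinuum.Crystallization.Cruxes.FluxCellKepler.SlabLadder

open scoped BigOperators Classical
open Filter Topology
open Literature.MathematicalPhysics.StatisticalMechanics
open Summit.AtomisticToContinuum.Crystallization.Theorems.FluxCellKeplerSingleScale
  (LayeredGood layeredGood_mono card_bad_le)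
open Summit.AtomisticToContinuum.Crystallization.Theorems.ChargedEnergyGapNegative
  (eStar card_mul_eStar_le crysEnergyLimit)

local notation "E3" => EuclideanSpace ℝ (Fin 3)

/-- FLOOR(P₀): `N · e(P₀) ≤ E(x)` for every Lennard-Jones ground state (verbatim the floor's first hypothesis). -/
def Floor (P₀ : PeriodicConfiguration 3) : Prop :=
  ∀ (N : ℕ) (x : Fin N → E3), IsGroundState lennardJones x →
    (N : ℝ) * P₀.energyPerParticle lennardJones ≤ interactionEnergy lennardJones x

/-- `W`-SLAB-GOOD SITE (the floor's goodness predicate with the window cut down to the height window `W`): some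
admissible layered template (spacing `a ∈ [47/50, 1]`, rigid motion `A`, Hägg word `s`, Barlow registry, gaps in
`[39a/50, 17a/20]`) matches the configuration around `x i` two-way with tolerance `η` ON THE SLAB-BALL
`{v : ‖v‖ ≤ R, ⟪v, A (layerNormal 1)⟫ ∈ W}` — template points of the slab-ball are `η`-close to particles, particles of
the slab-ball are `η`-close to template points.  `W = univ`: the floor's `LayeredGood R η` (`slabGood_univ_iff`). -/
def SlabGood (W : Set ℝ) (R η : ℝ) {N : ℕ} (x : Fin N → E3) (i : Fin N) : Prop :=
  ∃ a : ℝ, 47 / 50 ≤ a ∧ a ≤ 1 ∧ ∃ (A : E3 →ₗᵢ[ℝ] E3) (s : ℤ → ℤ) (z : ℤ → ℝ), IsHaggSeq s ∧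
    (∀ m : ℤ, 39 / 50 * a ≤ z (m + 1) - z m ∧ z (m + 1) - z m ≤ 17 / 20 * a) ∧
    let S : Set E3 := {p | ∃ m k l : ℤ, p = A (((k : ℝ) • triangularVec₁ a) + ((l : ℝ) • triangularVec₂ a) +
      ((haggLabel s m : ℝ) • barlowOffset a) + (z m • layerNormal 1))}
    (∀ p ∈ S, ‖p‖ ≤ R → inner ℝ p (A (layerNormal 1)) ∈ W → ∃ j : Fin N, dist (x j - x i) p ≤ η) ∧
    (∀ j : Fin N, ‖x j - x i‖ ≤ R → inner ℝ (x j - x i) (A (layerNormal 1)) ∈ W →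
      ∃ p ∈ S, dist (x j - x i) p ≤ η)

/-- `W`-SLAB BUDGET: at every scale `(R,η)` some `c > 0` prices the sites that are not `W`-slab-good against the
excess energy over `N · e(P₀)` (`W = univ`: the floor's budget). -/
def SlabBudget (W : Set ℝ) (P₀ : PeriodicConfiguration 3) : Prop :=
  ∀ R η : ℝ, 0 < R → 0 < η → ∃ c : ℝ, 0 < c ∧
    ∀ (N : ℕ) (x : Fin N → E3), IsGroundState lennardJones x →
      c * (Nat.card {i : Fin N // ¬ SlabGood W R η x i} : ℝ) ≤
        interactionEnergy lennardJones x - (N : ℝ) * P₀.energyPerParticle lennardJones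

/-- Periodic windows at every scale along `x` (verbatim the conclusion of `FluxTubeKepler.PeriodicGivenLayered`). -/
def HasPeriodicWindows (x : (N : ℕ) → (Fin N → E3)) : Prop :=
  ∃ P : PeriodicConfiguration 3, ∀ R ε : ℝ, 0 < ε → ∃ᶠ N in atTop, ∃ t : E3,
    (∀ s ∈ P.points, ‖s‖ ≤ R → ∃ i : Fin N, dist (x N i + t) s ≤ ε) ∧
    (∀ i : Fin N, ‖x N i + t‖ ≤ R → ∃ s ∈ P.points, dist (x N i + t) s ≤ ε)

/-- THE FAMILY `SlabRung W`: FLOOR(P₀) + the `W`-slab budget ⇒ periodic windows along every sequence of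
Lennard-Jones ground states.  `W = univ` is the floor (`slabRung_univ`), smaller `W` = stronger rung
(`slabRung_mono`), `W = ∅` would make the budget vacuous (FLOOR alone ⇒ periodic windows: the summit's conjunct). -/
def SlabRung (W : Set ℝ) : Prop :=
  ∀ P₀ : PeriodicConfiguration 3, Floor P₀ → SlabBudget W P₀ →
    ∀ x : (N : ℕ) → (Fin N → E3), (∀ N, IsGroundState lennardJones (x N)) → HasPeriodicWindows x

/-- **The deciding rung** `InterlayerBlindRung := SlabRung [-1/2, 1/2]`: the certificate only has to inspect the
THIN SLAB of half-height `1/2` (below every admissible gap `≥ 39/50 · 47/50`) around each site — i.e. to certify that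
the site's own layer is a perfect triangular patch of radius `R` with empty half-slabs above and below; the stacking
data of adjacent layers (relative rotation, registry, gap, spacing mismatch) are never charged. -/
def InterlayerBlindRung : Prop := SlabRung (Set.Icc (-(1 / 2 : ℝ)) (1 / 2))

/-! ## Bookkeeping: the floor is the member `W = univ`; monotonicity of the dial -/

/-- A larger height window asks more: `SlabGood` is antitone in `W`. -/
theorem slabGood_anti {W W' : Set ℝ} (hW : W ⊆ W') {R η : ℝ} {N : ℕ} (x : Fin N → E3) (i : Fin N) :
    SlabGood W' R η x i → SlabGood W R η x i := by
  rintro ⟨a, ha₁, ha₂, A, s, z, hs, hz, h₁, h₂⟩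
  refine ⟨a, ha₁, ha₂, A, s, z, hs, hz, ?_, ?_⟩
  · intro p hp hpR hpW
    exact h₁ p hp hpR (hW hpW)
  · intro j hj hjW
    exact h₂ j hj (hW hjW)

theorem layeredGood_of_slabGood_univ {R η : ℝ} {N : ℕ} (x : Fin N → E3) (i : Fin N) :
    SlabGood Set.univ R η x i → LayeredGood R η x i := by
  rintro ⟨a, ha₁, ha₂, A, s, z, hs, hz, h₁, h₂⟩
  refine ⟨a, ha₁, ha₂, A, s, z, hs, hz, ?_, ?_⟩
  · intro p hp hpR
    exact h₁ p hp hpR (Set.mem_univ _)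
  · intro j hj
    exact h₂ j hj (Set.mem_univ _)

theorem slabGood_univ_of_layeredGood {R η : ℝ} {N : ℕ} (x : Fin N → E3) (i : Fin N) :
    LayeredGood R η x i → SlabGood Set.univ R η x i := by
  rintro ⟨a, ha₁, ha₂, A, s, z, hs, hz, h₁, h₂⟩
  refine ⟨a, ha₁, ha₂, A, s, z, hs, hz, ?_, ?_⟩
  · intro p hp hpR _
    exact h₁ p hp hpR
  · intro j hj _
    exact h₂ j hj

/-- The floor's predicate is the member `W = univ` of the family. -/
theorem slabGood_univ_iff {R η : ℝ} {N : ℕ} (x : Fin N → E3) (i : Fin N) :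
    SlabGood Set.univ R η x i ↔ LayeredGood R η x i :=
  ⟨layeredGood_of_slabGood_univ x i, slabGood_univ_of_layeredGood x i⟩

/-- `SlabGood W` is antitone in the radius and monotone in the tolerance. [folklore] -/
theorem slabGood_mono_scale {W : Set ℝ} {R R' η η' : ℝ} (hR : R ≤ R') (hη : η' ≤ η) {N : ℕ}
    (x : Fin N → E3) (i : Fin N) : SlabGood W R' η' x i → SlabGood W R η x i := by
  rintro ⟨a, ha₁, ha₂, A, s, z, hs, hz, h₁, h₂⟩
  refine ⟨a, ha₁, ha₂, A, s, z, hs, hz, ?_, ?_⟩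
  · intro p hp hpR hpW
    obtain ⟨j, hj⟩ := h₁ p hp (hpR.trans hR) hpW
    exact ⟨j, hj.trans hη⟩
  · intro j hj hjW
    obtain ⟨p, hp, hjp⟩ := h₂ j (hj.trans hR) hjW
    exact ⟨p, hp, hjp.trans hη⟩

/-- The budget is antitone in the dial: a budget pricing the larger bad set prices the smaller one. -/
theorem slabBudget_anti {W W' : Set ℝ} (hW : W ⊆ W') (P₀ : PeriodicConfiguration 3) :
    SlabBudget W' P₀ → SlabBudget W P₀ := by
  intro hB R η hR hη
  obtain ⟨c, hc, hcB⟩ := hB R η hR hη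
  refine ⟨c, hc, fun N x hx => le_trans ?_ (hcB N x hx)⟩
  have hle : Nat.card {i : Fin N // ¬ SlabGood W R η x i} ≤ Nat.card {i : Fin N // ¬ SlabGood W' R η x i} := by
    rw [Nat.card_eq_fintype_card, Nat.card_eq_fintype_card]
    exact Fintype.card_subtype_mono _ _ fun i hi hg => hi (slabGood_anti hW x i hg)
  exact mul_le_mul_of_nonneg_left (by exact_mod_cast hle) hc.le

/-! ## F3 — the family specialises to the proved floor -/

/-- `SlabRung univ` is the floor: the seed theorem followed by the proved `PeriodicGivenLayered`. -/
theorem slabRung_univ : SlabRung Set.univ := by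
  intro P₀ hF hB x hx
  refine Theses.FluxTubeKepler.PeriodicGivenLayered_holds x hx
    (Theorems.FluxTubeKeplerFloorGivesLayered.FloorGivesLayered_proof P₀ hF ?_ x hx)
  intro R η hR hη
  obtain ⟨c, hc, hcB⟩ := hB R η hR hη
  refine ⟨c, hc, fun N y hy => ?_⟩
  show c * (Nat.card {i : Fin N // ¬ LayeredGood R η y i} : ℝ) ≤ _
  refine le_trans ?_ (hcB N y hy)
  have hle : Nat.card {i : Fin N // ¬ LayeredGood R η y i} ≤
      Nat.card {i : Fin N // ¬ SlabGood Set.univ R η y i} := by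
    rw [Nat.card_eq_fintype_card, Nat.card_eq_fintype_card]
    exact Fintype.card_subtype_mono _ _ fun i hi hg => hi (layeredGood_of_slabGood_univ y i hg)
  exact mul_le_mul_of_nonneg_left (by exact_mod_cast hle) hc.le

/-! ## Dial monotonicity (harder-to-easier = enlarging the inspected height window `W`) -/

theorem slabRung_mono {W W' : Set ℝ} (hW : W ⊆ W') : SlabRung W → SlabRung W' :=
  fun H P₀ hF hB x hx => H P₀ hF (slabBudget_anti hW P₀ hB) x hx

/-- The deciding rung gives back the floor member (informational `specialises`). -/
theorem slabRung_univ_of_interlayerBlindRung (h : InterlayerBlindRung) : SlabRung Set.univ :=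
  slabRung_mono (Set.subset_univ _) h

/-! ## F4 — on-path lemmas: the sub-problem implies every member -/

theorem slabRung_of_crystallization (W : Set ℝ) (h : _root_.Crystallization) : SlabRung W :=
  fun _ _ _ x hx =>
    Theorems.ChessboardParticlePlanesPeriodicWindowsIffCrystallization.periodicWindows_of_crystallization h x hx

@[aesop safe apply]
theorem InterlayerBlindRung_of_Crystallization (h : _root_.Crystallization) : InterlayerBlindRung :=
  slabRung_of_crystallization _ h

/-! ## How the rung relieves the parent crux `FluxCellKepler` (documentation, sorry-free) -/

/-- The floor-and-`W`-slab-budget package (what a Kepler-type certificate that only ever inspects the height window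
`W` around a site delivers). -/
def SlabKeplerFloor (W : Set ℝ) : Prop := ∃ P₀ : PeriodicConfiguration 3, Floor P₀ ∧ SlabBudget W P₀

theorem slabKeplerFloor_anti {W W' : Set ℝ} (hW : W ⊆ W') : SlabKeplerFloor W' → SlabKeplerFloor W := by
  rintro ⟨P₀, hF, hB⟩
  exact ⟨P₀, hF, slabBudget_anti hW P₀ hB⟩

theorem windows_of_slabRung {W : Set ℝ} (h : SlabRung W) (hK : SlabKeplerFloor W) :
    ∀ x : (N : ℕ) → (Fin N → E3), (∀ N, IsGroundState lennardJones (x N)) → HasPeriodicWindows x := by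
  obtain ⟨P₀, hF, hB⟩ := hK
  exact fun x hx => h P₀ hF hB x hx

/-- The parent crux gives the package at `W = univ` (proved `KeplerEnergyFloor` + minimal distance); the rung says a
certificate delivering it at `W = [-1/2, 1/2]` — charging a site only for a defect of its own layer — would do. -/
theorem slabKeplerFloor_univ_of_fluxCellKepler (hK : Theses.FluxTubeKepler.FluxCellKepler) :
    SlabKeplerFloor Set.univ := by
  obtain ⟨P₀, hF, hB⟩ := Theorems.keplerEnergyFloor_proof hK LennardJonesMinimalDistance_holds
  refine ⟨P₀, hF, fun R η hR hη => ?_⟩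
  obtain ⟨c, hc, hcB⟩ := hB R η hR hη
  refine ⟨c, hc, fun N y hy => ?_⟩
  have hcB' : c * (Nat.card {i : Fin N // ¬ LayeredGood R η y i} : ℝ) ≤
      interactionEnergy lennardJones y - (N : ℝ) * P₀.energyPerParticle lennardJones := hcB N y hy
  refine le_trans ?_ hcB'
  have hle : Nat.card {i : Fin N // ¬ SlabGood Set.univ R η y i} ≤
      Nat.card {i : Fin N // ¬ LayeredGood R η y i} := by
    rw [Nat.card_eq_fintype_card, Nat.card_eq_fintype_card]
    exact Fintype.card_subtype_mono _ _ fun i hi hg => hi (slabGood_univ_of_layeredGood y i hg)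
  exact mul_le_mul_of_nonneg_left (by exact_mod_cast hle) hc.le


/-! ## The line: laminarity from thin slabs (geometry), stacking selection from energy

Currency.  For a set `T ⊆ ℝ³` and `p ∈ T` the SITE ENERGY is `e_p(T) = Σ'_{q ∈ T, q ≠ p} V_LJ(|p − q|)` and the
boundary weight of a finite window `W ⊆ T` is `∂W = Σ_{p∈W} (1 + dist(p, T∖W))⁻³` — the currency of the landed
window bounds `LayeredHull.stub_windowBounds` and of the sibling line `Lines/AffineBlindRung.lean`, with
`N·e* ≤ E(N)` (`card_mul_eStar_le`) and `E(N)/N → e*` (`crysEnergyLimit`). -/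

/-- `Near ζ ρ S q` (verbatim from `Lines/AffineBlindRung.lean`): seen from the point `q`, the set `S` is two-way
`ζ`-close on the `ρ`-ball to an ADMISSIBLE layered template (spacing in `[47/50, 1]`, gaps in the box, Barlow
registry, rigid motion) — the floor's template family. -/
def Near (ζ ρ : ℝ) (S : Set E3) (q : E3) : Prop :=
  ∃ a : ℝ, 47 / 50 ≤ a ∧ a ≤ 1 ∧ ∃ (A : E3 →ₗᵢ[ℝ] E3) (s : ℤ → ℤ) (z : ℤ → ℝ), IsHaggSeq s ∧
    (∀ m : ℤ, 39 / 50 * a ≤ z (m + 1) - z m ∧ z (m + 1) - z m ≤ 17 / 20 * a) ∧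
    let T : Set E3 := {p | ∃ m k l : ℤ, p = A (((k : ℝ) • triangularVec₁ a) + ((l : ℝ) • triangularVec₂ a) +
      ((haggLabel s m : ℝ) • barlowOffset a) + (z m • layerNormal 1))}
    (∀ p' ∈ T, ‖p'‖ ≤ ρ → ∃ p ∈ S, dist (p - q) p' ≤ ζ) ∧
    (∀ p ∈ S, ‖p - q‖ ≤ ρ → ∃ p' ∈ T, dist (p - q) p' ≤ ζ)

/-- LAMINAR TRIANGULAR STACK (the structure the thin-slab budget leaves unpriced): in the global frame `A`, layer
`m` is the perfect triangular lattice of spacing `a m`, turned inside its plane by `B m` (a linear isometry fixing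
the normal `layerNormal 1 = e₃`), shifted by the in-plane offset `o m`, at height `z m`. -/
def stackSet (A : E3 →ₗᵢ[ℝ] E3) (a : ℤ → ℝ) (B : ℤ → (E3 →ₗᵢ[ℝ] E3)) (o : ℤ → E3) (z : ℤ → ℝ) : Set E3 :=
  {p | ∃ m k l : ℤ, p = A (B m (((k : ℝ) • triangularVec₁ (a m)) + ((l : ℝ) • triangularVec₂ (a m))) + o m +
    (z m • layerNormal 1))}

/-- Admissible stack data: every spacing in the box `[47/50, 1]`, every `B m` fixes the normal, every offset is
in-plane, consecutive heights increase by at least `2/5` (NO upper bound on the gaps, NO relation between the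
rotations / spacings / offsets of different layers — that is the point). -/
def IsStackDatum (a : ℤ → ℝ) (B : ℤ → (E3 →ₗᵢ[ℝ] E3)) (o : ℤ → E3) (z : ℤ → ℝ) : Prop :=
  (∀ m : ℤ, 47 / 50 ≤ a m ∧ a m ≤ 1) ∧ (∀ m : ℤ, B m (layerNormal 1) = layerNormal 1) ∧
  (∀ m : ℤ, inner ℝ (o m) (layerNormal 1) = 0) ∧ (∀ m : ℤ, 2 / 5 ≤ z (m + 1) - z m)

/-- `StackGood ρ ζ x i`: the `ρ`-ball around `x i` is two-way `ζ`-matched to an admissible laminar triangular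
stack. -/
def StackGood (ρ ζ : ℝ) {N : ℕ} (x : Fin N → E3) (i : Fin N) : Prop :=
  ∃ (A : E3 →ₗᵢ[ℝ] E3) (a : ℤ → ℝ) (B : ℤ → (E3 →ₗᵢ[ℝ] E3)) (o : ℤ → E3) (z : ℤ → ℝ), IsStackDatum a B o z ∧
    (∀ p ∈ stackSet A a B o z, ‖p‖ ≤ ρ → ∃ j : Fin N, dist (x j - x i) p ≤ ζ) ∧
    (∀ j : Fin N, ‖x j - x i‖ ≤ ρ → ∃ p ∈ stackSet A a B o z, dist (x j - x i) p ≤ ζ)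

/-- THIN-SLAB DEFECTS ARE SPARSE along `x`: at every scale `(R, η)` and every density `θ > 0`, eventually at most
`θN` sites are not `W`-slab-good (what FLOOR + the `W`-slab budget deliver, `fewSlabBad_of_budget`). -/
def FewSlabBad (W : Set ℝ) (x : (N : ℕ) → (Fin N → E3)) : Prop :=
  ∀ R η θ : ℝ, 0 < R → 0 < η → 0 < θ →
    ∀ᶠ N in atTop, (Nat.card {i : Fin N // ¬ SlabGood W R η (x N) i} : ℝ) ≤ θ * N

/-- STACKING GAP (the statement of Stub 2): for every locality `(ζ, ρ)` there are `g > 0` and `C` such that every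
finite window `W` of every admissible laminar triangular stack `T` satisfies
`Σ_{p∈W} e_p(T) ≥ 2e*·#W + 2g·#{p ∈ W : ¬ Near ζ ρ T p} − C·∂W`. -/
def StackingGap : Prop :=
  ∀ ζ ρ : ℝ, 0 < ζ → 0 < ρ → ∃ g C : ℝ, 0 < g ∧
    ∀ (A : E3 →ₗᵢ[ℝ] E3) (a : ℤ → ℝ) (B : ℤ → (E3 →ₗᵢ[ℝ] E3)) (o : ℤ → E3) (z : ℤ → ℝ), IsStackDatum a B o z →
      ∀ W : Finset E3, (↑W : Set E3) ⊆ stackSet A a B o z →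
        2 * eStar * (W.card : ℝ) +
              2 * g * ((W.filter fun p => ¬ Near ζ ρ (stackSet A a B o z) p).card : ℝ) -
            C * ∑ p ∈ W, (1 + Metric.infDist p (stackSet A a B o z \ (↑W : Set E3)))⁻¹ ^ 3 ≤
          ∑ p ∈ W, (∑' q : {q : E3 // q ∈ stackSet A a B o z ∧ q ≠ p}, lennardJones (dist p (q : E3)))

/-! ### The stub statements as named propositions (verbatim; the selection stub takes the others as hypotheses) -/

/-- Statement of `stub_stackOfSlabGood` (verbatim; see there). [conjecture] -/
def Sig.stub_stackOfSlabGood : Prop :=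
  ∀ δ ρ ζ : ℝ, 0 < δ → 0 < ρ → 0 < ζ → ∃ R R' η : ℝ, 0 < R ∧ 0 < R' ∧ 0 < η ∧
    ∀ (N : ℕ) (x : Fin N → E3) (i : Fin N), (∀ j k : Fin N, j ≠ k → δ ≤ dist (x j) (x k)) →
      (∀ j : Fin N, ‖x j - x i‖ ≤ R' → SlabGood (Set.Icc (-(1 / 2 : ℝ)) (1 / 2)) R η x j) →
      StackGood ρ ζ x i

/-- Statement of `stub_stackingSelection` (verbatim; see there; the proved matching lemma `nearGood` below is
available to its prover by name and is therefore not a hypothesis). [conjecture] -/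
def Sig.stub_stackingSelection : Prop :=
  StackingGap → Sig.stub_stackOfSlabGood →
    ∀ x : (N : ℕ) → (Fin N → E3), (∀ N, IsGroundState lennardJones (x N)) →
      FewSlabBad (Set.Icc (-(1 / 2 : ℝ)) (1 / 2)) x →
      ∀ η θ : ℝ, 0 < η → 0 < θ →
        ∀ᶠ N in atTop, (Nat.card {i : Fin N // ¬ LayeredGood 2 η (x N) i} : ℝ) ≤ θ * N

/-! ### The declared stubs (the only `sorry`s of the file) -/

/-- **Stub 1 — laminarity from thin slabs (potential-free geometry; new, M–L).**  For every separation `δ > 0`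
and every target `(ρ, ζ)` there are a certificate scale `(R, η)` and a guard radius `R'` such that: if a
`δ`-separated configuration is thin-slab-good (window `[-1/2, 1/2]`, scale `(R, η)`) at every site within `R'` of
`x i`, then the `ρ`-ball around `x i` is two-way `ζ`-matched to an admissible laminar triangular stack
(`StackGood ρ ζ x i`).  Intended proof: each certificate makes its site's layer a perfect triangular patch of radius
`R` (spacing in the box) with no particle at heights in `(2η, 1/2]` on either side; two certified patches whose
centres are `≤ R'` apart and whose planes make an angle `α` force, by walking `≤ R/2` lattice steps (height steps
`≤ sin α < 1/2 − 3η`) from the higher patch towards the lower one, a particle into the other's forbidden half-slab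
unless `R sin α ≤ 2(R' + 1)`; so all planes met in the `ρ`-ball are parallel up to `O(R'/R)`, the particles group
into layers with gaps `≥ 1/2 − 3η ≥ 2/5`, and each layer is read off one certificate (two certificates of the same
layer agree up to `2η` on their common disc of radius `≥ R − R'`, hence define the same lattice up to `O(η)`
drift); choose `R ≥ C ρ R'/ζ`, `η ≤ ζ/C`, `R' = ρ + 2`; absent layers of the stack are parked at heights beyond
`ρ`.  May fail only through the bookkeeping of the drift constants (every slack is an `∃`), or if a certified
layer could be matched by the template's layer `m₀` while a second template layer also met the slab — excluded:
template layers are `≥ 0.733 − η > 1/2 + η` apart in height. [conjecture] -/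
theorem stub_stackOfSlabGood :
    ∀ δ ρ ζ : ℝ, 0 < δ → 0 < ρ → 0 < ζ → ∃ R R' η : ℝ, 0 < R ∧ 0 < R' ∧ 0 < η ∧
    ∀ (N : ℕ) (x : Fin N → E3) (i : Fin N), (∀ j k : Fin N, j ≠ k → δ ≤ dist (x j) (x k)) →
      (∀ j : Fin N, ‖x j - x i‖ ≤ R' → SlabGood (Set.Icc (-(1 / 2 : ℝ)) (1 / 2)) R η x j) →
      StackGood ρ ζ x i := by
  sorry

/-- **Stub 2 — the stacking gap of laminar Lennard-Jones lattice sums (THE NEW INPUT; load-bearing;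
configuration-free).**  For every locality `(ζ, ρ)` some `g > 0` and `C` satisfy: for every admissible laminar
triangular stack `T = stackSet A a B o z` (`IsStackDatum a B o z`) and every finite window `W ⊆ T`,
`Σ_{p∈W} e_p(T) ≥ 2e*·#W + 2g·#{p ∈ W : ¬ Near ζ ρ T p} − C·Σ_{p∈W}(1 + dist(p, T∖W))⁻³`.
Intended proof (`V(r) = r⁻¹²/12 − r⁻⁶/6`): (i) `2E(W) ≥ 2e*·#W` for the window as a finite configuration
(`card_mul_eStar_le`), and the cross terms `Σ_{p∈W, q∈T∖W} V` are `≥ −C·∂W` (tails `r⁻⁶`, uniform local finiteness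
of admissible stacks: spacing `≥ 47/50`, gaps `≥ 2/5`); so the content is the DEFECT TERM relative to the laminar
ground energy `e_lam := inf` of the energy per site over admissible stacks (`≥ e*`); (ii) per adjacent layer pair
the interlayer energy per site of the upper layer is `F(u_p, h)`, `F(u, h) = Σ_{q ∈ L} V(√(|u − q|² + h²))` the
atom-above-lattice landscape of the lower layer `L`, `u_p` the lateral position (disregistry) of `p`; `F( · , · )`
is minimised exactly at the hollow sites with the in-box gap `h*(a)` (three bonds at the potential minimum; on-top
and bridge positions are strictly worse, large `h` loses the binding — exfoliation —, small `h` is repulsive), with a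
quadratic margin, uniformly for spacings in the box — a finite-dimensional statement certified by interval lattice
sums; (iii) for a TWISTED or SPACING-MISMATCHED adjacent pair the disregistries `{u_p}` of the sites of a
`ρ`-window are NOT all `ζ/C`-close to hollow sites unless the pair is aligned-and-commensurate up to `O(ζ/ρ)` on
that window (a rigid rotation / dilation moves lateral positions by `≥ θρ` across the window), so a non-`Near`
site has, within distance `ρ`, a site paying `≥ c(ζ/Cρ)²` above `F_min` — or an intralayer spacing / gap off the
admissible box paying by the equations of state; divide the blame by the `≤ C'ρ³` sites within `ρ` (this is the
finite-window form of the disregistry AVERAGE: for an incommensurate pair the mean of `F(u_p, h)` over a large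
window is the torus average of `F( · , h)` — Cazeaux–Luskin–Massatt 2020, Prop. 1.2 (Birkhoff property) and
Prop. 2.2 —, for a coincidence twist a coset average, both `> F_min`; the stub needs only the windowed, quantified
version); (iv) second-neighbour layers interact through `r⁻⁶` tails at distance `≥ 4/5`; their registry dependence
(the fcc/hcp splitting, `≈ 10⁻³ |e*|`) is NOT claimed — the admissible family contains every Barlow word — and
their isotropic part enters `e_lam` on both sides.  May fail if some twisted or height-modulated laminar stack of
rigid triangular layers had Lennard-Jones energy per site BELOW every admissible Barlow stack (then `e_lam` is
attained off the admissible family and the defect term is false for that stack: the cheapest falsifier is the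
certified bilayer landscape `min_{θ, u, h, a, a'} F̄ ≥ F(hollow, h*)` with the `30°` twist and the `Σ7`
(`21.8°`) coincidence twist as first cases), or through the uniformity of `g` in the unbounded gaps (handled by
exfoliation monotonicity: `F(u, h) ↑ 0` for `h ≥ 17a/20`). [conjecture] -/
theorem stub_stackingGap : StackingGap := by
  sorry

/-- **Stub 3 — stacking selection along ground states (Lennard-Jones block accounting; load-bearing analysis).**
Given the stacking gap and the laminarity lemma (and the proved matching lemma `nearGood`): along every sequence
of Lennard-Jones ground states whose thin-slab defects are sparse at every scale (`FewSlabBad [-1/2, 1/2]`), the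
radius-`2` FLOOR defects are sparse —
for every `η, θ > 0`, eventually at most `θN` sites are not two-way `(2, η)`-layered-good.  Intended proof (as in
the sibling `AffineLadder.stub_affineSelection`, with the strained template replaced by the laminar stack): fix
`ζ := η/2`, `ρ' := 3 + η`, the gap data `g, C` of Stub 2 at `(ζ, ρ')`, a block side `L`, a matching radius
`ρ ≥ 4L + ρ' + 2` and tolerance `ζ' ≤ min (η/4) (δ/8)` (`δ` from `LennardJonesMinimalDistance_holds`), and the
certificate scale `(R, η₀)` and guard `R'` of Stub 1 for `(δ, ρ, ζ')`; by `FewSlabBad` and `δ`-separation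
(`≤ (2R'/δ + 1)³` sites within `R'` of any site), eventually all but `θ'N` sites have every site within `R'`
thin-slab-good, hence are `StackGood ρ ζ'` (Stub 1).  Tile space by `L`-cubes; a cube met by the `ρ/2`-ball of a
stack-good site inherits its stack `T` (stack points are uniformly separated: `≥ 47/50` within a layer, `≥ 2/5`
across layers), particles of the cube are in bijection with the stack points of the cube, and
`Σ_{j ∈ cube} siteE_j(x_N) ≥ Σ_{p} e_p(T) − #·ω(ζ', L)` (Lipschitz bound of `V` on `[δ/2, ∞)` and `r⁻⁶` tails;
`ω → 0` uniformly over admissible stacks); Stub 2 makes the cube pay `2g` per non-`Near` point beyond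
`2e*·# − C·C'L²`; `nearGood` makes every particle matched to a `Near` point `(2, η)`-layered-good; uncovered cubes hold
only budgeted sites with `siteE ≥ −C₀`.  Summing against `2E(x_N) ≤ 2N·e* + o(N)` (`crysEnergyLimit`, ground
states): `2g·#{matched to non-Near points} ≤ o(N) + N(2ω + CC'/L + C₁θ')`, `≤ θN/2` for `L`, `1/ζ'`, `1/θ'`
large.  May fail through the bookkeeping of cubes met by two different stack-good balls (the two stacks match the
same particles on the overlap, so either may be charged), or if `ω` were not uniform over admissible stacks with
arbitrarily large gaps (it is: local finiteness is uniform, and far layers only improve the tail). [conjecture] -/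
theorem stub_stackingSelection : StackingGap → Sig.stub_stackOfSlabGood →
    ∀ x : (N : ℕ) → (Fin N → E3), (∀ N, IsGroundState lennardJones (x N)) →
      FewSlabBad (Set.Icc (-(1 / 2 : ℝ)) (1 / 2)) x →
      ∀ η θ : ℝ, 0 < η → 0 < θ →
        ∀ᶠ N in atTop, (Nat.card {i : Fin N // ¬ LayeredGood 2 η (x N) i} : ℝ) ≤ θ * N := by
  sorry

/-! ### Sorry-free glue -/

/-- **Matching composition — Near-matched particles are floor-good (potential-free; sorry-free).**  If the
`R'`-ball around `x i` is two-way `η'`-matched with a set `S`, `x j − x i` is `η'`-close to a point `q ∈ S` with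
`‖q‖ + ρ + 1 ≤ R'`, and `S` seen from `q` is `Near ζ ρ` an admissible template `T`, then `j` is
`(2, η)`-layered-good (template `T`) as soon as `2η' + ζ ≤ η`, `2 + η ≤ ρ`, `η', ζ ≤ 1`.  Proof: two triangle
inequalities through the identity `x j' − x j − p' = (x j' − x i − p) − (x j − x i − q) + (p − q − p')`.  This is
the sibling line's registered stub `AffineLadder.stub_nearGood` (`Lines/AffineBlindRung.lean`) with the strained
template generalised to an arbitrary set `S`; the prover of `stub_stackingSelection` uses it by name. [folklore] -/
theorem nearGood :
    ∀ (R' η' ζ ρ η : ℝ), 0 ≤ η' → η' ≤ 1 → 0 ≤ ζ → ζ ≤ 1 → 2 * η' + ζ ≤ η → 2 + η ≤ ρ →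
    ∀ (N : ℕ) (x : Fin N → E3) (i : Fin N) (S : Set E3),
      (∀ p ∈ S, ‖p‖ ≤ R' → ∃ j : Fin N, dist (x j - x i) p ≤ η') →
      (∀ j : Fin N, ‖x j - x i‖ ≤ R' → ∃ p ∈ S, dist (x j - x i) p ≤ η') →
      ∀ (j : Fin N) (q : E3), q ∈ S → dist (x j - x i) q ≤ η' → ‖q‖ + ρ + 1 ≤ R' → Near ζ ρ S q →
        LayeredGood 2 η x j := by
  intro R' η' ζ ρ η hη'0 hη'1 hζ0 hζ1 hsum hρ N x i S hS1 hS2 j q hq hjq hqR hnear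
  obtain ⟨a, ha1, ha2, A, s, z, hs, hz, hT1, hT2⟩ := hnear
  rw [dist_eq_norm] at hjq
  refine ⟨a, ha1, ha2, A, s, z, hs, hz, ?_, ?_⟩
  · intro p' hp' hp'2
    have hp'ρ : ‖p'‖ ≤ ρ := by linarith
    obtain ⟨p, hpS, hpd⟩ := hT1 p' hp' hp'ρ
    rw [dist_eq_norm] at hpd
    have hpq : ‖p - q‖ ≤ ‖p'‖ + ζ := by
      have := norm_le_insert' (p - q) p'
      linarith
    have hpR : ‖p‖ ≤ R' := by
      have := norm_le_insert' p q
      linarith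
    obtain ⟨j', hj'⟩ := hS1 p hpS hpR
    rw [dist_eq_norm] at hj'
    refine ⟨j', ?_⟩
    have e : x j' - x j - p' = (x j' - x i - p) - (x j - x i - q) + (p - q - p') := by abel
    rw [dist_eq_norm, e]
    have h1 := norm_add_le ((x j' - x i - p) - (x j - x i - q)) (p - q - p')
    have h2 := norm_sub_le (x j' - x i - p) (x j - x i - q)
    linarith
  · intro j' hj'2
    have hxR : ‖x j' - x i‖ ≤ R' := by
      have e : x j' - x i = (x j' - x j) + (x j - x i - q) + q := by abel
      rw [e]
      have h1 := norm_add_le ((x j' - x j) + (x j - x i - q)) q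
      have h2 := norm_add_le (x j' - x j) (x j - x i - q)
      linarith
    obtain ⟨p, hpS, hpd⟩ := hS2 j' hxR
    rw [dist_eq_norm] at hpd
    have hpq : ‖p - q‖ ≤ ρ := by
      have e : p - q = (x j' - x j) - (x j' - x i - p) + (x j - x i - q) := by abel
      rw [e]
      have h1 := norm_add_le ((x j' - x j) - (x j' - x i - p)) (x j - x i - q)
      have h2 := norm_sub_le (x j' - x j) (x j' - x i - p)
      linarith
    obtain ⟨p', hp'T, hp'd⟩ := hT2 p hpS hpq
    rw [dist_eq_norm] at hp'd
    refine ⟨p', hp'T, ?_⟩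
    have e : x j' - x j - p' = (x j' - x i - p) - (x j - x i - q) + (p - q - p') := by abel
    rw [dist_eq_norm, e]
    have h1 := norm_add_le ((x j' - x i - p) - (x j - x i - q)) (p - q - p')
    have h2 := norm_sub_le (x j' - x i - p) (x j - x i - q)
    linarith

/-- **Counting** (the seed's `eventually_exists_not_bad` with a density; verbatim from the sibling lines with the
goodness predicate `SlabGood W`): under FLOOR(P₀) (`e(P₀) = e*`, `floor_iff_eq_eStar`) and the `W`-slab budget,
`c·#bad ≤ E(N) − N·e*` and `E(N)/N → e*` (`crysEnergyLimit`) give, for every `θ > 0`, eventually `#bad ≤ θN`.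
[folklore] -/
theorem fewSlabBad_of_budget (W : Set ℝ) (P₀ : PeriodicConfiguration 3) (hF : Floor P₀) (hB : SlabBudget W P₀)
    (x : (N : ℕ) → (Fin N → E3)) (hx : ∀ N, IsGroundState lennardJones (x N)) : FewSlabBad W x := by
  intro R η θ hR hη hθ
  obtain ⟨c, hc, hcB⟩ := hB R η hR hη
  have heq := (Theorems.FluxTubeKeplerFloorGivesLayered.floor_iff_eq_eStar P₀).1 hF
  have hlim := crysEnergyLimit
  have hlt : (⨅ Q : PeriodicConfiguration 3, Q.energyPerParticle lennardJones) < eStar + c * θ := by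
    change eStar < eStar + c * θ
    nlinarith
  have hev : ∀ᶠ N : ℕ in atTop, groundStateEnergy lennardJones 3 N / N < eStar + c * θ :=
    hlim.eventually (gt_mem_nhds hlt)
  filter_upwards [hev, Filter.eventually_gt_atTop 0] with N hN hNpos
  have h1 := hcB N (x N) (hx N)
  rw [heq, (hx N).2] at h1
  have hNr : (0 : ℝ) < N := by exact_mod_cast hNpos
  have h2 : groundStateEnergy lennardJones 3 N < (eStar + c * θ) * N := by
    rwa [div_lt_iff₀ hNr] at hN
  have h3 : c * (Nat.card {i : Fin N // ¬ SlabGood W R η (x N) i} : ℝ) < c * (θ * N) := by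
    nlinarith
  exact (lt_of_mul_lt_mul_left h3 hc.le).le
/-- (Verbatim from the sibling lines `Lines/RegistryBlindRung.lean`, `Lines/ScaleBlindRung.lean`.)  **Sparse
radius-`2` floor defects ⇒ good sites at every scale, frequently** (landed chart gluing
`FluxCellKeplerSingleScale.card_bad_le` at `R₀ = 2`, `δ`-separation of ground states `LennardJonesMinimalDistance_holds`,
and counting). [folklore] -/
theorem good_of_sparse (x : (N : ℕ) → (Fin N → E3)) (hx : ∀ N, IsGroundState lennardJones (x N))
    (hsp : ∀ η θ : ℝ, 0 < η → 0 < θ →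
      ∀ᶠ N in atTop, (Nat.card {i : Fin N // ¬ LayeredGood 2 η (x N) i} : ℝ) ≤ θ * N) :
    ∀ R η : ℝ, 0 < R → 0 < η → ∃ᶠ N in atTop, ∃ i : Fin N, LayeredGood R η (x N) i := by
  intro R η hR hη
  obtain ⟨δ, hδ, hsep⟩ := LennardJonesMinimalDistance_holds
  obtain ⟨η', hη', M, hM, hcard⟩ := card_bad_le (le_refl (2 : ℝ)) hδ R η hη
  have hθ : (0 : ℝ) < 1 / (2 * M) := by positivity
  have hev := (hsp η' (1 / (2 * M)) hη' hθ).and (eventually_ge_atTop 1)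
  refine hev.frequently.mono fun N hN => ?_
  obtain ⟨hNsp, hN1⟩ := hN
  by_contra hno
  have hno' : ∀ i : Fin N, ¬ LayeredGood R η (x N) i := fun i hi => hno ⟨i, hi⟩
  have hall : (N : ℝ) ≤ Nat.card {i : Fin N // ¬ LayeredGood R η (x N) i} := by
    rw [Nat.card_eq_fintype_card, Fintype.card_subtype]
    have : (Finset.univ.filter fun i : Fin N => ¬ LayeredGood R η (x N) i) = Finset.univ :=
      Finset.filter_true_of_mem fun i _ => hno' i
    rw [this, Finset.card_univ, Fintype.card_fin]
  have h1 := hcard N (x N) (hsep N (x N) (hx N))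
  have hN1' : (1 : ℝ) ≤ N := by exact_mod_cast hN1
  have hchain : (N : ℝ) ≤ M * (1 / (2 * M) * N) := hall.trans (h1.trans (mul_le_mul_of_nonneg_left hNsp hM.le))
  have hMM : M * (1 / (2 * M) * N) = N / 2 := by field_simp
  rw [hMM] at hchain
  linarith

open Summit.AtomisticToContinuum.Crystallization.Theorems.FluxTubeKeplerFloorGivesLayered
  (spacing_selection match_dilate layered_pt_scale) in
/-- (Verbatim from the sibling lines `Lines/PosTolRung.lean`, `Lines/VacancyBlindRung.lean`,
`Lines/RegistryBlindRung.lean`, `Lines/ScaleBlindRung.lean`.)  Steps 2–3 of the seed, isolated: good sites at every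
scale (with scale-dependent spacings IN THE BOX) give the layered-windows hypothesis of
`FluxTubeKepler.PeriodicGivenLayered` (one spacing by `spacing_selection` — Bolzano–Weierstrass on the compact box,
transfer by dilation `match_dilate` + `layered_pt_scale`, translation `t := −x N i`). [folklore] -/
theorem hasLayeredWindows_of_good (x : (N : ℕ) → (Fin N → E3))
    (hgood : ∀ R η : ℝ, 0 < R → 0 < η → ∃ᶠ N in atTop, ∃ i : Fin N, LayeredGood R η (x N) i) :
    ∃ a : ℝ, 47 / 50 ≤ a ∧ a ≤ 1 ∧ ∀ R ε : ℝ, 0 < ε → ∃ᶠ N in Filter.atTop,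
      ∃ (A : E3 →ₗᵢ[ℝ] E3) (t : E3) (s : ℤ → ℤ) (z : ℤ → ℝ), IsHaggSeq s ∧
      (∀ m : ℤ, 39 / 50 * a ≤ z (m + 1) - z m ∧ z (m + 1) - z m ≤ 17 / 20 * a) ∧
      let S : Set E3 := {p | ∃ m i j : ℤ, p = A (((i : ℝ) • triangularVec₁ a) +
        ((j : ℝ) • triangularVec₂ a) + ((haggLabel s m : ℝ) • barlowOffset a) + (z m • layerNormal 1))};
      (∀ p ∈ S, ‖p‖ ≤ R → ∃ i : Fin N, dist (x N i + t) p ≤ ε) ∧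
      (∀ i : Fin N, ‖x N i + t‖ ≤ R → ∃ p ∈ S, dist (x N i + t) p ≤ ε) := by
  -- Step 2: one spacing for all scales, the transfer being dilation of the whole layered datum
  have hgood' : ∀ R η : ℝ, 0 < R → 0 < η → ∃ᶠ N in atTop, ∃ i : Fin N, ∃ a : ℝ, 47 / 50 ≤ a ∧ a ≤ 1 ∧
      ∃ (A : E3 →ₗᵢ[ℝ] E3) (s : ℤ → ℤ) (z : ℤ → ℝ), IsHaggSeq s ∧
        (∀ m : ℤ, 39 / 50 * a ≤ z (m + 1) - z m ∧ z (m + 1) - z m ≤ 17 / 20 * a) ∧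
        let S : Set E3 := {p | ∃ m k l : ℤ, p = A (((k : ℝ) • triangularVec₁ a) +
          ((l : ℝ) • triangularVec₂ a) + ((haggLabel s m : ℝ) • barlowOffset a) + (z m • layerNormal 1))};
        (∀ p ∈ S, ‖p‖ ≤ R → ∃ j : Fin N, dist (x N j - x N i) p ≤ η) ∧
        (∀ j : Fin N, ‖x N j - x N i‖ ≤ R → ∃ p ∈ S, dist (x N j - x N i) p ≤ η) := hgood
  obtain ⟨a, ha1, ha2, hwin⟩ := spacing_selection hgood' fun R ε hR hε => by
    obtain ⟨η₁, hη₁0, hη₁ε, hη₁1⟩ : ∃ η₁ : ℝ, 0 < η₁ ∧ η₁ ≤ ε ∧ η₁ ≤ 1 :=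
      ⟨min ε 1, lt_min hε one_pos, min_le_left _ _, min_le_right _ _⟩
    have hR1 : 0 < R + 1 := by linarith
    obtain ⟨θ, hθ0, hθR⟩ : ∃ θ : ℝ, 0 < θ ∧ θ * (R + 1) = η₁ / 2 :=
      ⟨η₁ / 2 / (R + 1), by positivity, by field_simp⟩
    refine ⟨47 / 50 * θ, by positivity, R + 1, η₁ / 2, by positivity, ?_⟩
    intro a b R' η' ha hb hab hRR' hη' N i hG
    obtain ⟨A, s, z, hs, hbox, hM₁, hM₂⟩ := hG
    have ha0 : 0 < a := by linarith
    have hb0 : 0 < b := by linarith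
    obtain ⟨ρ, hρ0, hρb⟩ : ∃ ρ : ℝ, 0 < ρ ∧ ρ * b = a :=
      ⟨a / b, div_pos ha0 hb0, div_mul_cancel₀ a hb0.ne'⟩
    have habs : |b - a| < 47 / 50 * θ := hab
    have h1ρ : |1 - ρ| ≤ θ := by
      have e1 : 1 - ρ = (b - a) / b := by rw [← hρb]; field_simp
      rw [e1, abs_div, abs_of_pos hb0, div_le_iff₀ hb0]
      nlinarith [abs_nonneg (b - a)]
    have h1ρ' : |ρ⁻¹ - 1| ≤ θ := by
      have e1 : ρ⁻¹ - 1 = (b - a) / a := by rw [← hρb]; field_simp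
      rw [e1, abs_div, abs_of_pos ha0, div_le_iff₀ ha0]
      nlinarith [abs_nonneg (b - a)]
    refine ⟨A, s, fun m => ρ * z m, hs, fun m => ?_, ?_⟩
    · obtain ⟨hl, hu⟩ := hbox m
      have hl' := mul_le_mul_of_nonneg_left hl hρ0.le
      have hu' := mul_le_mul_of_nonneg_left hu hρ0.le
      constructor
      · calc 39 / 50 * a = ρ * (39 / 50 * b) := by rw [← hρb]; ring
          _ ≤ ρ * (z (m + 1) - z m) := hl'
          _ = ρ * z (m + 1) - ρ * z m := by ring
      · calc ρ * z (m + 1) - ρ * z m = ρ * (z (m + 1) - z m) := by ring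
          _ ≤ ρ * (17 / 20 * b) := hu'
          _ = 17 / 20 * a := by rw [← hρb]; ring
    · have hscale : ∀ m k l : ℤ, A (((k : ℝ) • triangularVec₁ a) + ((l : ℝ) • triangularVec₂ a) +
          ((haggLabel s m : ℝ) • barlowOffset a) + ((ρ * z m) • layerNormal 1)) =
          ρ • A (((k : ℝ) • triangularVec₁ b) + ((l : ℝ) • triangularVec₂ b) +
          ((haggLabel s m : ℝ) • barlowOffset b) + (z m • layerNormal 1)) := by
        intro m k l
        rw [← hρb]
        exact layered_pt_scale A ρ b s z m k l
      dsimp only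
      refine match_dilate (fun j => x N j - x N i) _ _ hθ0 hθR hη₁ε hη₁1 hρ0 h1ρ h1ρ' hRR' hη'
        ?_ ?_ hM₁ hM₂
      · rintro p ⟨m, k, l, rfl⟩
        exact ⟨m, k, l, (hscale m k l).symm⟩
      · rintro p' ⟨m, k, l, rfl⟩
        exact ⟨_, ⟨m, k, l, rfl⟩, hscale m k l⟩
  -- Step 3: read the fixed-spacing good site at radius `max R 1` and translate by `t := -x N i`
  refine ⟨a, ha1, ha2, fun R ε hε => ?_⟩
  have hR' : 0 < max R 1 := lt_max_of_lt_right one_pos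
  refine (hwin (max R 1) ε hR' hε).mono fun N hN => ?_
  obtain ⟨i, hi⟩ := hN
  obtain ⟨A, s, z, hs, hbox, hM₁, hM₂⟩ := hi
  refine ⟨A, -x N i, s, z, hs, hbox, ?_⟩
  have hsub : ∀ j : Fin N, x N j + -x N i = x N j - x N i := fun j =>
    (sub_eq_add_neg (x N j) (x N i)).symm
  intro S
  refine ⟨fun p hp hpR => ?_, fun j hj => ?_⟩
  · obtain ⟨j, hj⟩ := hM₁ p hp (hpR.trans (le_max_left R 1))
    exact ⟨j, by rw [hsub j]; exact hj⟩
  · rw [hsub j] at hj ⊢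
    exact hM₂ j (hj.trans (le_max_left R 1))

/-! ### The skeleton theorem: the rung BY NAME from the three stub statements (sorry-free) -/

/-- **Assembly.** `stub_stackingGap → stub_stackOfSlabGood → stub_stackingSelection → InterlayerBlindRung`:
under FLOOR and the thin-slab budget the thin-slab defects are sparse at every scale
(`fewSlabBad_of_budget`); stubs 1–3 make the radius-`2` floor defects sparse along the sequence; the landed chart
gluing turns sparsity into floor-good sites at every scale (`good_of_sparse`), hence layered windows
(`hasLayeredWindows_of_good`) and periodic windows (proved `PeriodicGivenLayered`). -/
theorem InterlayerBlindRung_of (h₁ : StackingGap) (h₂ : Sig.stub_stackOfSlabGood)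
    (h₃ : Sig.stub_stackingSelection) : InterlayerBlindRung := by
  intro P₀ hF hB x hx
  have hsp := h₃ h₁ h₂ x hx (fewSlabBad_of_budget _ P₀ hF hB x hx)
  have hgood := good_of_sparse x hx hsp
  exact Theses.FluxTubeKepler.PeriodicGivenLayered_holds x hx (hasLayeredWindows_of_good x hgood)

/-- **The closed skeleton instance**: the rung by name from the three declared stubs (the only `sorry`s of this
file enter here). [conjecture] -/
theorem InterlayerBlindRung_skeleton : InterlayerBlindRung :=
  InterlayerBlindRung_of stub_stackingGap stub_stackOfSlabGood stub_stackingSelection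

end Summit.AtomisticToContinuum.Crystallization.Cruxes.FluxCellKepler.SlabLadder

end
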